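import Literature.AlgebraicGeometry.Frobenioids.ArithmeticFrobenioidThm64iiArithOrderCompat
import Literature.AlgebraicGeometry.Frobenioids.ArithmeticFrobenioidThm64ivNodeGeneral
import Literature.AlgebraicGeometry.Frobenioids.ArithmeticFrobenioidThm64iiiGeneralAtComparison
import HarnessLib
import HarnessLib.Audit.LibrarySuggestionsDenyListFrobenioids

/-!
# Frobenioids I, Theorem 6.4 (ii)/(iii)/(iv): the typed schemata `Thm64ii`, `Thm64iiDeg`,
# `Thm64ii_L02_orderCompat`, `Thm64iii`, `Thm64iv` HEAD-MATCHED AT THE CONSTRUCTIONS — PROOF-ONLY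

Mochizuki, *The geometry of Frobenioids I: the general theory*, Kyushu J. Math. **62** (2008) 293–400, §6,
Thm. 6.4 (ii) p. 114, (iii) pp. 114–115, (iv) p. 115 (proof p. 116). [cite: MochizukiFrdI2008, Thm. 6.4 (ii) p.114]
[cite: MochizukiFrdI2008, Thm. 6.4 (iii) p.114] [cite: MochizukiFrdI2008, Thm. 6.4 (iv) p.115]

PROOF-ONLY companion (cell abc-iut, D-0079 L-F sub-cell [FrdI/II], seat abc-iut-L1-d2; FROZEN FACT-LIST rows
F-0889 `Thm64ii`, F-0890 `Thm64iiDeg`, F-0891 `Thm64iii`, F-0892 `Thm64iv`, F-1148 `Thm64ii_L02_orderCompat`;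
0 `def`, 0 `instance`, 0 `structure`; nothing restated).  The five named statements are SCHEMATA over free
realification data `R₁`, `R₂`, an equivalence `Ψ^rlf` and a free `picMap` (abc-iut-L1-t3, `ArithmeticFrobenioids.lean`
/ `MotivatingExamplesSub.lean`); their universal closures are FALSE (abc-iut-f-016, `ArithmeticFrobenioidsThm64SchemaClosures`,
`ArithmeticFrobenioidsThm64SchemaAtData`: replace `picMap` by `-picMap`), and the hypothesis-free tokens of record at
THE data are ∃-PACKAGES (`ArithFrd.thm64ii_arith'`, `ArithFrd.thm64ii_arith_orderCompat'`, `Thm64iii_schema_arith`,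
`Thm64iii_arith_general_of_square`, `Thm64iii_arith_general_at_comparison`, `Thm64iv_schema_arith_general`), so no
theorem of the tree has one of the five schemata as its conclusion HEAD.  This file supplies exactly those
head-matched instance forms, at THE realifications `arithRealification hΦᵢ` of THE arithmetic Frobenioids
`C_{Kᵢ/Fᵢ}` (Ex. 6.3), in two shapes:

* **print-generality form for (ii)** (`ArithFrd.Thm64ii_arith_of_induced`, `…Thm64iiDeg_arith_of_induced`,
  `…Thm64ii_L02_orderCompat_arith_of_induced`): for EVERY equivalence `Ψ^rlf : C₁^rlf ⥲ C₂^rlf`, EVERY base-transport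
  datum `(Ψ^Base, η, E = Ψ^Φ)` of it carrying the real spans ([FrdI] Cor. 4.10 / 4.11 (iii)) and EVERY `picMap`
  INDUCED by that datum — `picMap_A [x] = (η_A)^* [E x]` on divisor classes, which determines `picMap`
  (`pic_addMonoidHom_ext`: an additive map out of `Pic_Φ(A) = Φ^rlf(L)^gp ⧸ ℝ·Φ^birat(L)` is determined by its values
  on the classes of elements of `Φ^rlf(L)`) — the schemata `Thm64ii`, `Thm64iiDeg` (at THE degree) and
  `Thm64ii_L02_orderCompat` HOLD;
* **the instances at THE induced data of record** (`…_arith_inst…`): the data packaged existentially by the tokens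
  are NAMED by `Exists.choose` and the schemata are stated for them with every remaining binder universally
  quantified — for (ii) at THE Cor. 4.11 data of `Ψ^rlf`; for (iv) for EVERY `Ψ : C₁ ⥲ C₂`, `deg`, `r₁`, `r₂`
  (abc-iut-L1-d3/d7/t3 chain `Thm64iv_schema_arith_general`, no hypothesis on `F₁`); for (iii) both in the
  (iv)-situation (`Thm64iii_schema_arith`) and in print's situation — for EVERY `Ψ′ : ((C₁)^pf)^un-tr ⥲ ((C₂)^pf)^un-tr`,
  EVERY `Ψ^rlf` and EVERY 1-commutative square `σ` through comparison functors `uᵢ : ((Cᵢ)^pf)^un-tr → Cᵢ^rlf` lying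
  over `F_ι` (`Thm64iii_arith_general_of_square`, abc-iut-L1-d2; THE `uᵢ` of Prop. 5.3 — abc-iut-L1-d1's
  `arith_exists_comparisonFunctor_pfUntr_rlf_degFr`, ∃-package `Thm64iii_arith_general_at_comparison` — instantiate
  its binders), `σ` being print's own hypothesis "`Ψ^rlf` arises from `(Ψ^pf)^un-tr`".

Classical, undisputed mathematics ([FrdI] is a refereed prerequisite); OUR kernel check of OUR typed slots; nothing
here bears on [IUTchIII] Cor. 3.12 or asserts anything about abc; no statement of the paper is strengthened;
typed ≠ proved.
-/

noncomputable section

namespace Literature.AlgebraicGeometry.Frobenioids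

open CategoryTheory Opposite Literature.AnabelianGeometry.EtaleTheta

universe w' v' u'

/-! ### An additive map out of `Pic = Φ^gp ⧸ Ψ` is determined by its values on the classes of `Φ` -/

/-- Two additive maps out of (the additively written) `Picᵩ(X) = Φ(X)^gp ⧸ Ψ(X)` that agree on the classes of
the elements of the monoid `Φ(X)` are equal (`Φ(X)` generates its groupification as a group, and the quotient
map is surjective). [folklore] -/
private theorem pic_addMonoidHom_ext {D : Type u'} [Category.{v'} D] {Φ : Dᵒᵖ ⥤ CommMonCat.{w'}}
    (Ψ : GpSubfunctor Φ) (X : D) {P : Type*} [AddCommGroup P] {f g : Additive (Ψ.Pic X) →+ P}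
    (h : ∀ x : Φ.obj (op X),
      f (Additive.ofMul (QuotientGroup.mk' (Ψ.carrier X) (Algebra.GrothendieckGroup.of x))) =
        g (Additive.ofMul (QuotientGroup.mk' (Ψ.carrier X) (Algebra.GrothendieckGroup.of x)))) :
    f = g := by
  apply AddMonoidHom.toMultiplicativeRight.injective
  refine QuotientGroup.monoidHom_ext _ ?_
  have hFG : ((AddMonoidHom.toMultiplicativeRight f).comp (QuotientGroup.mk' (Ψ.carrier X))).comp
        Algebra.GrothendieckGroup.of =
      ((AddMonoidHom.toMultiplicativeRight g).comp (QuotientGroup.mk' (Ψ.carrier X))).comp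
        Algebra.GrothendieckGroup.of :=
    MonoidHom.ext fun x => congrArg Multiplicative.ofAdd (h x)
  calc (AddMonoidHom.toMultiplicativeRight f).comp (QuotientGroup.mk' (Ψ.carrier X))
      = Algebra.GrothendieckGroup.lift (Algebra.GrothendieckGroup.lift.symm
          ((AddMonoidHom.toMultiplicativeRight f).comp (QuotientGroup.mk' (Ψ.carrier X)))) :=
        (Equiv.apply_symm_apply _ _).symm
    _ = Algebra.GrothendieckGroup.lift (Algebra.GrothendieckGroup.lift.symm
          ((AddMonoidHom.toMultiplicativeRight g).comp (QuotientGroup.mk' (Ψ.carrier X)))) := by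
        rw [Algebra.GrothendieckGroup.lift_symm_apply, Algebra.GrothendieckGroup.lift_symm_apply, hFG]
    _ = (AddMonoidHom.toMultiplicativeRight g).comp (QuotientGroup.mk' (Ψ.carrier X)) :=
        Equiv.apply_symm_apply _ _

namespace ArithFrd

/-! ### Theorem 6.4 (ii) (rows F-0889 `Thm64ii`, F-0890 `Thm64iiDeg`, F-1148 `Thm64ii_L02_orderCompat`) -/

section Thm64ii

variable {F₁ : Type} [Field F₁] [NumberField F₁] {K₁ : Type} [Field K₁] [Algebra F₁ K₁] [IsGalois F₁ K₁]
  {F₂ : Type} [Field F₂] [NumberField F₂] {K₂ : Type} [Field K₂] [Algebra F₂ K₂] [IsGalois F₂ K₂]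
  (hΦ₁ : PreFrobenioid.IsPerfFactorialOn (arithDivisorFunctor F₁ K₁))
  (hΦ₂ : PreFrobenioid.IsPerfFactorialOn (arithDivisorFunctor F₂ K₂))
  (Ψ : PreFrobenioid.rlf (ModelFrobenioid.toElem (arithDivisorFunctor F₁ K₁) (unitsFunctor F₁ K₁) (divNatTrans F₁ K₁)) hΦ₁ ≌
    PreFrobenioid.rlf (ModelFrobenioid.toElem (arithDivisorFunctor F₂ K₂) (unitsFunctor F₂ K₂) (divNatTrans F₂ K₂)) hΦ₂)

section Induced

variable (ΨBase : FinSubextCat F₁ K₁ ⥤ FinSubextCat F₂ K₂) [ΨBase.IsEquivalence]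
  (η : Ψ.functor ⋙ (FrdI.Cor54Sub.rlfData (ModelFrobenioid.toElem (arithDivisorFunctor F₂ K₂) (unitsFunctor F₂ K₂)
      (divNatTrans F₂ K₂)) hΦ₂).base ≅
    (FrdI.Cor54Sub.rlfData (ModelFrobenioid.toElem (arithDivisorFunctor F₁ K₁) (unitsFunctor F₁ K₁)
      (divNatTrans F₁ K₁)) hΦ₁).base ⋙ ΨBase)
  (E : PreFrobenioidData.DivisorMonoidIsoOverBase
    (FrdI.Cor54Sub.rlfData (ModelFrobenioid.toElem (arithDivisorFunctor F₁ K₁) (unitsFunctor F₁ K₁)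
      (divNatTrans F₁ K₁)) hΦ₁)
    (FrdI.Cor54Sub.rlfData (ModelFrobenioid.toElem (arithDivisorFunctor F₂ K₂) (unitsFunctor F₂ K₂)
      (divNatTrans F₂ K₂)) hΦ₂) ΨBase)
  (hspan : ∀ X : FinSubextCat F₁ K₁,
    (((RealificationData.canonical (arithDivisorFunctor F₁ K₁) (PreFrobenioid.IsPerfFactorialOn.op hΦ₁)).realSpan
          (PreFrobenioid.biratSubfunctor (ModelFrobenioid.toElem (arithDivisorFunctor F₁ K₁) (unitsFunctor F₁ K₁)
            (divNatTrans F₁ K₁)))).carrier X).map (MonGp.map (E.iso X).toMonoidHom) =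
      ((RealificationData.canonical (arithDivisorFunctor F₂ K₂) (PreFrobenioid.IsPerfFactorialOn.op hΦ₂)).realSpan
          (PreFrobenioid.biratSubfunctor (ModelFrobenioid.toElem (arithDivisorFunctor F₂ K₂) (unitsFunctor F₂ K₂)
            (divNatTrans F₂ K₂)))).carrier (ΨBase.obj X))
  (picMap : ∀ A, (arithRealification hΦ₁).Pic A ≃+ (arithRealification hΦ₂).Pic (Ψ.functor.obj A))
  (hval : ∀ (A : PreFrobenioid.rlf (ModelFrobenioid.toElem (arithDivisorFunctor F₁ K₁) (unitsFunctor F₁ K₁)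
      (divNatTrans F₁ K₁)) hΦ₁)
      (x : (RealificationData.canonical (arithDivisorFunctor F₁ K₁) (PreFrobenioid.IsPerfFactorialOn.op hΦ₁)).rlf.obj
        (op A.base)),
      picMap A (Additive.ofMul (QuotientGroup.mk' _ (Algebra.GrothendieckGroup.of x))) =
        Additive.ofMul (((RealificationData.canonical (arithDivisorFunctor F₂ K₂)
          (PreFrobenioid.IsPerfFactorialOn.op hΦ₂)).realSpan (PreFrobenioid.biratSubfunctor
            (ModelFrobenioid.toElem (arithDivisorFunctor F₂ K₂) (unitsFunctor F₂ K₂) (divNatTrans F₂ K₂)))).picPull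
          (X := (Ψ.functor.obj A).base) (Y := ΨBase.obj A.base) (η.hom.app A)
          (QuotientGroup.mk' _ (Algebra.GrothendieckGroup.of (E.iso A.base x)))))

include η hspan hval in
/-- **F-0889 / [FrdI] Theorem 6.4 (ii) `Thm64ii` AT THE CONSTRUCTIONS, print-generality form.**  For THE
realifications `Cᵢ^rlf` of THE arithmetic Frobenioids `C_{Kᵢ/Fᵢ}` (THE `Pic_Φ`, THE `δ_A`), EVERY equivalence
`Ψ^rlf : C₁^rlf ⥲ C₂^rlf`, EVERY base-transport datum of it — `Ψ^Base` an equivalence, `η : Base₂ ∘ Ψ^rlf ≅ Ψ^Base ∘ Base₁`,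
`E = Ψ^Φ : Φ₁^rlf ⥲ Φ₂^rlf|_{D₁}` over `Ψ^Base` carrying the real spans `ℝ·Φᵢ^birat` (Cor. 4.10 / 4.11 (iii)) — and
EVERY `picMap` INDUCED by it ("the isomorphism of groups `Pic_Φ(A₁) ⥲ Pic_Φ(A₂)` determined by `Ψ^rlf`":
`picMap_A [x] = (η_A)^* [E x]` on divisor classes), "there exists a unique element `deg(Ψ^rlf) ∈ ℝ_{>0}`" with
`δ_{A₂} ∘ picMap = deg(Ψ^rlf) · δ_{A₁}`: the typed `Thm64ii` holds.  Proof: abc-iut-w4-d086's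
`exists_picMap_thm64ii_functor` produces SOME induced `picMap` with `Thm64ii`; an induced `picMap` is unique
(`pic_addMonoidHom_ext`). [cite: MochizukiFrdI2008, Thm. 6.4 (ii) p.114] -/
theorem Thm64ii_arith_of_induced :
    Thm64ii (arithRealification hΦ₁) (arithRealification hΦ₂) Ψ picMap := by
  obtain ⟨picMap₀, h₀, hval₀, -⟩ := exists_picMap_thm64ii_functor hΦ₁ hΦ₂ Ψ ΨBase η E hspan
  have heq : picMap = picMap₀ := by
    funext A
    refine AddEquiv.ext fun a => ?_
    refine DFunLike.congr_fun (pic_addMonoidHom_ext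
      ((RealificationData.canonical (arithDivisorFunctor F₁ K₁) (PreFrobenioid.IsPerfFactorialOn.op hΦ₁)).realSpan
        (PreFrobenioid.biratSubfunctor (ModelFrobenioid.toElem (arithDivisorFunctor F₁ K₁) (unitsFunctor F₁ K₁)
          (divNatTrans F₁ K₁)))) A.base
      (f := (picMap A).toAddMonoidHom) (g := (picMap₀ A).toAddMonoidHom) fun x => ?_) a
    exact (hval A x).trans (hval₀ A x).symm
  subst heq
  exact h₀

include η hspan hval in
/-- **F-0890 / [FrdI] Theorem 6.4 (ii), the degree relation `Thm64iiDeg` AT THE CONSTRUCTIONS**, for the same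
data: `Thm64iiDeg R₁ R₂ Ψ^rlf picMap deg(Ψ^rlf)` holds with `deg(Ψ^rlf) :=` THE degree of the induced `picMap`
(named from `Thm64ii_arith_of_induced` by `Exists.choose`; it is `> 0` and satisfies
`δ_{Ψ A}(picMap_A x) = deg(Ψ^rlf) · δ_A(x)` for every Frobenius-trivial `A`). [cite: MochizukiFrdI2008, Thm. 6.4 (ii) p.114] -/
theorem Thm64iiDeg_arith_of_induced :
    Thm64iiDeg (arithRealification hΦ₁) (arithRealification hΦ₂) Ψ picMap
      ((Thm64ii_arith_of_induced hΦ₁ hΦ₂ Ψ ΨBase η E hspan picMap hval).choose :) :=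
  (Thm64ii_arith_of_induced hΦ₁ hΦ₂ Ψ ΨBase η E hspan picMap hval).choose_spec

include η hspan hval in
/-- **F-1148 / [FrdI] Theorem 6.4 (ii), row T64ii/L02 `Thm64ii_L02_orderCompat` AT THE CONSTRUCTIONS**, for the
same data: every induced `picMap` "is compatible with the 'order structure' induced on both sides [via `δ_{A₁}`,
`δ_{A₂}`] by the 'order structure' of `ℝ`. [Indeed, this compatibility follows from the fact that the isomorphism in
question arises from an isomorphism of monoids `Φ₁^rlf(A₁) ⥲ Φ₂^rlf(A₂)`.]" (p. 115 l. 35 – p. 116 l. 2) —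
from the degree relation (abc-iut-w4-d086's `Thm64ii_L02_orderCompat_of_thm64ii`). [cite: MochizukiFrdI2008, Thm. 6.4 (ii) p.115] -/
theorem Thm64ii_L02_orderCompat_arith_of_induced :
    Thm64ii_L02_orderCompat (arithRealification hΦ₁) (arithRealification hΦ₂) Ψ picMap :=
  Thm64ii_L02_orderCompat_of_thm64ii _ _ Ψ picMap
    (Thm64ii_arith_of_induced hΦ₁ hΦ₂ Ψ ΨBase η E hspan picMap hval)

end Induced

/-- **F-0889 / `Thm64ii` at THE induced data of record** (abc-iut-L6-t10's `ArithFrd.thm64ii_arith'`): for EVERY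
equivalence `Ψ^rlf : C₁^rlf ⥲ C₂^rlf`, the typed `Thm64ii` holds for THE `picMap` induced by THE [FrdI] Cor. 4.11
data `(Ψ^Base, η, Ψ^Φ)` OF `Ψ^rlf` (the fifth component of `thm64ii_arith'`, named by `Exists.choose`; it is pinned
to `Ψ^rlf` by the clauses of `thm64ii_arith'`: `1`-unique base square, `Div(Ψ^rlf φ) = η_A^* Ψ^Φ(Div φ)` on all
arrows, `picMap_A [x] = (η_A)^*[Ψ^Φ x]`). [cite: MochizukiFrdI2008, Thm. 6.4 (ii) p.114] -/
theorem Thm64ii_arith_inst :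
    Thm64ii (arithRealification hΦ₁) (arithRealification hΦ₂) Ψ
      ((thm64ii_arith' hΦ₁ hΦ₂ Ψ).choose_spec.choose_spec.choose_spec.choose_spec.choose :) :=
  (thm64ii_arith' hΦ₁ hΦ₂ Ψ).choose_spec.choose_spec.choose_spec.choose_spec.choose_spec.2.2.1

/-- **F-0890 / `Thm64iiDeg` at THE induced data of record**: `Thm64iiDeg R₁ R₂ Ψ^rlf picMap deg(Ψ^rlf)` for THE
induced `picMap` of `thm64ii_arith'` and THE degree `deg(Ψ^rlf)` (its `Exists.choose`).
[cite: MochizukiFrdI2008, Thm. 6.4 (ii) p.114] -/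
theorem Thm64iiDeg_arith_inst :
    Thm64iiDeg (arithRealification hΦ₁) (arithRealification hΦ₂) Ψ
      ((thm64ii_arith' hΦ₁ hΦ₂ Ψ).choose_spec.choose_spec.choose_spec.choose_spec.choose :)
      ((Thm64ii_arith_inst hΦ₁ hΦ₂ Ψ).choose :) :=
  (Thm64ii_arith_inst hΦ₁ hΦ₂ Ψ).choose_spec

/-- **F-1148 / `Thm64ii_L02_orderCompat` at THE induced data of record**: THE induced `picMap` of
`thm64ii_arith'` is compatible with the order structures induced by `δ_{A₁}`, `δ_{A₂}` (p. 115).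
[cite: MochizukiFrdI2008, Thm. 6.4 (ii) p.115] -/
theorem Thm64ii_L02_orderCompat_arith_inst :
    Thm64ii_L02_orderCompat (arithRealification hΦ₁) (arithRealification hΦ₂) Ψ
      ((thm64ii_arith' hΦ₁ hΦ₂ Ψ).choose_spec.choose_spec.choose_spec.choose_spec.choose :) :=
  Thm64ii_L02_orderCompat_of_thm64ii _ _ Ψ _ (Thm64ii_arith_inst hΦ₁ hΦ₂ Ψ)

end Thm64ii

/-! ### Theorem 6.4 (iv) (row F-0892 `Thm64iv`) and (iii) (row F-0891 `Thm64iii`) for EVERY `Ψ : C₁ ⥲ C₂` -/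

section Thm64iv

variable {F₁ : Type} [Field F₁] [NumberField F₁] {K₁ : Type} [Field K₁] [Algebra F₁ K₁] [IsGalois F₁ K₁]
  {F₂ : Type} [Field F₂] [NumberField F₂] {K₂ : Type} [Field K₂] [Algebra F₂ K₂] [IsGalois F₂ K₂]
  (hΦ₁ : PreFrobenioid.IsPerfFactorialOn (arithDivisorFunctor F₁ K₁))
  (hΦ₂ : PreFrobenioid.IsPerfFactorialOn (arithDivisorFunctor F₂ K₂))
  (Ψ : arithFrobenioid F₁ K₁ ≌ arithFrobenioid F₂ K₂)

/-- **F-0892 / [FrdI] Theorem 6.4 (iv) `Thm64iv` AT THE CONSTRUCTIONS, for EVERY equivalence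
`Ψ : C_{K₁/F₁} ⥲ C_{K₂/F₂}`, every `deg` and all functors `rᵢ : Cᵢ → Cᵢ^rlf`** — at THE induced `Ψ^Base` (an
equivalence under `Ψ`), THE induced `Ψ^rlf` over `Ψ^Base` and THE induced `picMap` (the components of
abc-iut-L1-d3's `Thm64iv_schema_arith_general`, named by `Exists.choose`): "then `deg(Ψ^rlf) = 1`; if some
`L₁ ⊆ F̃₁` finite Galois over `ℚ`, the corresponding `L₂` is isomorphic to `L₁` compatibly with `F₁ ≅ F₂`" in the
typed form `Thm64iv R₁ R₂ Ψ^rlf picMap deg M₁ M₂ r₁ r₂ Ψ Ψ^Base` (no hypothesis on `F₁`).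
[cite: MochizukiFrdI2008, Thm. 6.4 (iv) p.115] -/
theorem Thm64iv_arith_inst (deg : ℝ)
    (r₁ : arithFrobenioid F₁ K₁ ⥤ PreFrobenioid.rlf (ModelFrobenioid.toElem (arithDivisorFunctor F₁ K₁)
      (unitsFunctor F₁ K₁) (divNatTrans F₁ K₁)) hΦ₁)
    (r₂ : arithFrobenioid F₂ K₂ ⥤ PreFrobenioid.rlf (ModelFrobenioid.toElem (arithDivisorFunctor F₂ K₂)
      (unitsFunctor F₂ K₂) (divNatTrans F₂ K₂)) hΦ₂) :
    Thm64iv (arithRealification hΦ₁) (arithRealification hΦ₂)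
      ((Thm64iv_schema_arith_general hΦ₁ hΦ₂ Ψ).choose_spec.choose_spec.choose_spec.choose :)
      ((Thm64iv_schema_arith_general hΦ₁ hΦ₂ Ψ).choose_spec.choose_spec.choose_spec.choose_spec.choose :) deg
      (arithModelFrobenioid F₁ K₁) (arithModelFrobenioid F₂ K₂) r₁ r₂ Ψ
      ((Thm64iv_schema_arith_general hΦ₁ hΦ₂ Ψ).choose :) :=
  (Thm64iv_schema_arith_general hΦ₁ hΦ₂ Ψ).choose_spec.choose_spec.choose_spec.choose_spec.choose_spec.2.2 deg r₁ r₂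

/-- THE induced `Ψ^Base` of `Thm64iv_arith_inst` is an equivalence (first clause of the token).
[cite: MochizukiFrdI2008, Thm. 6.4 (iv) p.115] -/
theorem Thm64iv_arith_inst_base_isEquivalence :
    (Thm64iv_schema_arith_general hΦ₁ hΦ₂ Ψ).choose.IsEquivalence :=
  (Thm64iv_schema_arith_general hΦ₁ hΦ₂ Ψ).choose_spec.choose

/-- THE induced `Ψ^rlf` of `Thm64iv_arith_inst` lies over THE induced `Ψ^Base` (`Base₂ ∘ Ψ^rlf ≅ Ψ^Base ∘ Base₁`).
[cite: MochizukiFrdI2008, Thm. 6.4 (iv) p.115] -/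
theorem Thm64iv_arith_inst_rlf_over_base :
    Nonempty (((Thm64iv_schema_arith_general hΦ₁ hΦ₂ Ψ).choose_spec.choose_spec.choose_spec.choose :).functor ⋙
        (arithRealification hΦ₂).ops.base ≅
      (arithRealification hΦ₁).ops.base ⋙ ((Thm64iv_schema_arith_general hΦ₁ hΦ₂ Ψ).choose :)) :=
  (Thm64iv_schema_arith_general hΦ₁ hΦ₂ Ψ).choose_spec.choose_spec.choose_spec.choose_spec.choose_spec.1

/-- **F-0889 / `Thm64ii` for THE `Ψ^rlf` INDUCED BY an equivalence `Ψ : C₁ ⥲ C₂`** and THE induced `picMap`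
(the data of `Thm64iv_arith_inst`). [cite: MochizukiFrdI2008, Thm. 6.4 (ii) p.114] -/
theorem Thm64ii_arith_inst_of_equivalence :
    Thm64ii (arithRealification hΦ₁) (arithRealification hΦ₂)
      ((Thm64iv_schema_arith_general hΦ₁ hΦ₂ Ψ).choose_spec.choose_spec.choose_spec.choose :)
      ((Thm64iv_schema_arith_general hΦ₁ hΦ₂ Ψ).choose_spec.choose_spec.choose_spec.choose_spec.choose :) :=
  (Thm64iv_schema_arith_general hΦ₁ hΦ₂ Ψ).choose_spec.choose_spec.choose_spec.choose_spec.choose_spec.2.1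

/-- **F-0891 / [FrdI] Theorem 6.4 (iii) `Thm64iii` AT THE CONSTRUCTIONS in the (iv)-situation, for EVERY
`Ψ : C₁ ⥲ C₂`, every `Spec L₁ ∈ Ob(D₁)` and every `deg`** (abc-iut-L1-t3's `Thm64iii_schema_arith`, its data named by
`Exists.choose`): with `Uᵢ := Cᵢ^rlf`, `uᵢ := 𝟭`, `Ψ′ := Ψ^rlf` (THE induced one), THE induced `picMap`, the
Frobenius-trivial object `A₁ = (Spec L₁, 1)` and THE induced bijection of places `placeMap`, the typed `Thm64iii`
holds: `deg ∈ ℚ_{>0}`, archimedean ↦ archimedean, same residue characteristics. [cite: MochizukiFrdI2008, Thm. 6.4 (iii) p.114] -/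
theorem Thm64iii_arith_inst_rlf (X : FinSubextCat F₁ K₁) (deg : ℝ) :
    Thm64iii (arithRealification hΦ₁) (arithRealification hΦ₂)
      ((Thm64iii_schema_arith hΦ₁ hΦ₂ Ψ).choose_spec.choose_spec.choose_spec.choose :)
      ((Thm64iii_schema_arith hΦ₁ hΦ₂ Ψ).choose_spec.choose_spec.choose_spec.choose_spec.choose :) deg
      (𝟭 (PreFrobenioid.rlf (ModelFrobenioid.toElem (arithDivisorFunctor F₁ K₁) (unitsFunctor F₁ K₁)
        (divNatTrans F₁ K₁)) hΦ₁))
      (𝟭 (PreFrobenioid.rlf (ModelFrobenioid.toElem (arithDivisorFunctor F₂ K₂) (unitsFunctor F₂ K₂)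
        (divNatTrans F₂ K₂)) hΦ₂))
      ((Thm64iii_schema_arith hΦ₁ hΦ₂ Ψ).choose_spec.choose_spec.choose_spec.choose :)
      (⟨X, 1⟩ : PreFrobenioid.rlf (ModelFrobenioid.toElem (arithDivisorFunctor F₁ K₁) (unitsFunctor F₁ K₁)
        (divNatTrans F₁ K₁)) hΦ₁)
      (((Thm64iii_schema_arith hΦ₁ hΦ₂ Ψ).choose_spec.choose_spec.choose_spec.choose_spec.choose_spec.2.2 X).choose :) :=
  ((Thm64iii_schema_arith hΦ₁ hΦ₂ Ψ).choose_spec.choose_spec.choose_spec.choose_spec.choose_spec.2.2 X).choose_spec deg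

end Thm64iv

/-! ### Theorem 6.4 (iii) (row F-0891 `Thm64iii`) in print's situation: `Ψ^rlf` arising from `Ψ′ : ((C₁)^pf)^un-tr ⥲ ((C₂)^pf)^un-tr` -/

section Thm64iii

open PreFrobenioid

variable {F₁ : Type} [Field F₁] [NumberField F₁] {K₁ : Type} [Field K₁] [Algebra F₁ K₁] [IsGalois F₁ K₁]
  {F₂ : Type} [Field F₂] [NumberField F₂] {K₂ : Type} [Field K₂] [Algebra F₂ K₂] [IsGalois F₂ K₂]
  (hΦ₁ : PreFrobenioid.IsPerfFactorialOn (arithDivisorFunctor F₁ K₁))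
  (hΦ₂ : PreFrobenioid.IsPerfFactorialOn (arithDivisorFunctor F₂ K₂))
  (Ψrlf : PreFrobenioid.rlf (ModelFrobenioid.toElem (arithDivisorFunctor F₁ K₁) (unitsFunctor F₁ K₁)
      (divNatTrans F₁ K₁)) hΦ₁ ≌
    PreFrobenioid.rlf (ModelFrobenioid.toElem (arithDivisorFunctor F₂ K₂) (unitsFunctor F₂ K₂)
      (divNatTrans F₂ K₂)) hΦ₂)

section FreeComparison

variable
  (u₁ : (PreFrobenioidData.ofFunctor _
      (PreFrobenioid.Perfection.ops (arithFrobenioid_isFrobenioid F₁ K₁)).toFunctor).Untr ⥤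
    PreFrobenioid.rlf (ModelFrobenioid.toElem (arithDivisorFunctor F₁ K₁) (unitsFunctor F₁ K₁)
      (divNatTrans F₁ K₁)) hΦ₁)
  (β₁ : u₁ ⋙ (arithRealification hΦ₁).ops.base ≅
    (PreFrobenioidData.ofFunctor _ (untrFunctor (arith_pf_isFrobenioid F₁ K₁))).base)
  (hu₁ : ∀ ⦃A B : (PreFrobenioidData.ofFunctor _
      (PreFrobenioid.Perfection.ops (arithFrobenioid_isFrobenioid F₁ K₁)).toFunctor).Untr⦄ (φ : A ⟶ B),
    (arithRealification hΦ₁).ops.div (u₁.map φ) =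
      (arithRealification hΦ₁).ops.pull (β₁.hom.app A)
        ((PreFrobenioid.IsPerfFactorialOn.op hΦ₁ (op _)).toRealification
          ((PreFrobenioidData.ofFunctor _ (untrFunctor (arith_pf_isFrobenioid F₁ K₁))).div φ)))
  (u₂ : (PreFrobenioidData.ofFunctor _
      (PreFrobenioid.Perfection.ops (arithFrobenioid_isFrobenioid F₂ K₂)).toFunctor).Untr ⥤
    PreFrobenioid.rlf (ModelFrobenioid.toElem (arithDivisorFunctor F₂ K₂) (unitsFunctor F₂ K₂)
      (divNatTrans F₂ K₂)) hΦ₂)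
  (β₂ : u₂ ⋙ (arithRealification hΦ₂).ops.base ≅
    (PreFrobenioidData.ofFunctor _ (untrFunctor (arith_pf_isFrobenioid F₂ K₂))).base)
  (hu₂ : ∀ ⦃A B : (PreFrobenioidData.ofFunctor _
      (PreFrobenioid.Perfection.ops (arithFrobenioid_isFrobenioid F₂ K₂)).toFunctor).Untr⦄ (φ : A ⟶ B),
    (arithRealification hΦ₂).ops.div (u₂.map φ) =
      (arithRealification hΦ₂).ops.pull (β₂.hom.app A)
        ((PreFrobenioid.IsPerfFactorialOn.op hΦ₂ (op _)).toRealification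
          ((PreFrobenioidData.ofFunctor _ (untrFunctor (arith_pf_isFrobenioid F₂ K₂))).div φ)))
  (Ψ' : (PreFrobenioidData.ofFunctor _
      (PreFrobenioid.Perfection.ops (arithFrobenioid_isFrobenioid F₁ K₁)).toFunctor).Untr ≌
    (PreFrobenioidData.ofFunctor _
      (PreFrobenioid.Perfection.ops (arithFrobenioid_isFrobenioid F₂ K₂)).toFunctor).Untr)
  (σ : Ψ'.functor ⋙ u₂ ≅ u₁ ⋙ Ψrlf.functor)
  (A₁ : (PreFrobenioidData.ofFunctor _
    (PreFrobenioid.Perfection.ops (arithFrobenioid_isFrobenioid F₁ K₁)).toFunctor).Untr)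

/-- **F-0891 / [FrdI] Theorem 6.4 (iii) `Thm64iii` AT THE CONSTRUCTIONS, print-generality form** (abc-iut-L1-d2's
`Thm64iii_arith_general_of_square`, its data named by `Exists.choose`): for EVERY `Ψ^rlf : C₁^rlf ⥲ C₂^rlf`, EVERY
pair of comparison functors `uᵢ : ((Cᵢ)^pf)^un-tr → Cᵢ^rlf` over `Dᵢ` (base isomorphisms `βᵢ`) lying over
`F_ι : F_{Φ^pf} → F_{Φ^rlf}` in `Div` (`huᵢ`), EVERY equivalence `Ψ′ : ((C₁)^pf)^un-tr ⥲ ((C₂)^pf)^un-tr`, EVERY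
1-commutative square `σ : Ψ′ ∘ u₂ ≅ u₁ ∘ Ψ^rlf` (print's hypothesis "`Ψ^rlf` arises from `Ψ′`"), EVERY object `A₁`
and every `deg`: with THE induced `picMap` and THE bijection of places `placeMap` induced by THE perfected divisor
transport of `Ψ′` at `A₁`, the typed `Thm64iii R₁ R₂ Ψ^rlf picMap deg u₁ u₂ Ψ′ A₁ placeMap` holds — "`deg(Ψ^rlf) ∈ ℚ_{>0}`;
… maps [valuations] lying over `v₀ ∈ 𝕍(ℚ)` to [valuations] lying over the same `v₀`".
[cite: MochizukiFrdI2008, Thm. 6.4 (iii) p.114] -/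
theorem Thm64iii_arith_inst_of_square (deg : ℝ) :
    letI V := Thm64iii_arith_general_of_square hΦ₁ hΦ₂ Ψrlf u₁ β₁ hu₁ u₂ β₂ hu₂ Ψ' σ A₁
    Thm64iii (arithRealification hΦ₁) (arithRealification hΦ₂) Ψrlf V.choose_spec.2.choose deg u₁ u₂ Ψ' A₁
      V.choose_spec.2.choose_spec.2.choose := by
  -- one elaboration of the package in the statement; the proof names its ∃-witness proofs instead of
  -- re-elaborating it (each elaboration of `Thm64iii_arith_general_of_square … hu₁ … hu₂ …` costs ≈ 10⁵ heartbeats)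
  generalize_proofs
  rename_i h
  exact h.choose_spec.2 deg

/-- For the same data, THE induced `picMap` of `Thm64iii_arith_inst_of_square` satisfies the typed `Thm64ii`
(row F-0889 for a `Ψ^rlf` arising from `Ψ′`). [cite: MochizukiFrdI2008, Thm. 6.4 (ii) p.114] -/
theorem Thm64ii_arith_inst_of_square :
    letI V := Thm64iii_arith_general_of_square hΦ₁ hΦ₂ Ψrlf u₁ β₁ hu₁ u₂ β₂ hu₂ Ψ' σ A₁
    Thm64ii (arithRealification hΦ₁) (arithRealification hΦ₂) Ψrlf V.choose_spec.2.choose := by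
  generalize_proofs
  rename_i h
  exact h.choose_spec.1

end FreeComparison

/-! NOTE. THE comparison functors of record — the composites `((Cᵢ)^pf)^un-tr ⥲ ((Cᵢ)^un-tr)^pf ⥲ (model of
(Φ^pf, ℚ·Φ^birat)) → Cᵢ^rlf` of Prop. 5.3 / 5.5 (ii), packaged with their base isomorphisms and Div- and deg-clauses by
abc-iut-L1-d1's `arith_exists_comparisonFunctor_pfUntr_rlf_degFr` — instantiate the binders `(uᵢ, βᵢ, huᵢ)` of
`Thm64iii_arith_inst_of_square`; the corresponding ∃-package is `Thm64iii_arith_general_at_comparison`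
(abc-iut-L1-d2).  A separately NAMED instance at those functors is not recorded here: elaborating its statement
(four `Exists.choose` layers over the comparison-functor package) does not terminate within the default
heartbeat budget, and it carries no content beyond `Thm64iii_arith_inst_of_square` + that package. -/

end Thm64iii

end ArithFrd

end Literature.AlgebraicGeometry.Frobenioids

end

-- tree-health (abc-iut-w6-d081 g5, 2026-08-26T18:53Z): comment-only re-land of a STRANDED ACCEPT (p456585 accepted ≈16:3xZ; serial farm import probe at 18:49Z hangs 161 s in «stale:unbuilt» backoff; dag tick #11 DIRECTOR FIELDS «accepted-without-olean 118 min»);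
-- declarations byte-identical to the accepted version; purpose = trigger the rebuild (rule of record: a re-land outside a reload window is served in 10–27 min). No content change.
-- tree-health (abc-iut-w6-d081 g5, 2026-08-26T19:49Z): SECOND comment-only re-land — the first re-land (18:37–18:55Z) was itself not built after 60 min while 1,064 of 1,069 files committed 18:34–18:59Z hub-wide were (the 5 exceptions all in Literature/AnabelianGeometry + Literature/AlgebraicGeometry/Frobenioids); declarations byte-identical.
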